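import Summits.KontsevichZagierPeriods.KontsevichZagierPeriods.Theorems.LinRedNormalFormArrangementNormalFormStubRebaseSimplePosOneFibreReduce
import Summits.KontsevichZagierPeriods.KontsevichZagierPeriods.Theorems.LinRedNormalFormArrangementNormalFormStubRebaseSimplePosOneFibreBlow

/-!
# Stub `stub_rebaseSimplePos`, part `rebaseSimplePos_oneFibre` (crux `ArrangementNormalForm`,
line `janus-bands`, v6.2) — sub-part `Apex`

Two sign cases of `stub_rebaseOne`'s analysis of a lettered band ABOVE its letter `0` with
transverse, non-parallel bounds `u < v`, uniformly in the silent base coordinates `x'`. Write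
`φ = v − u > 0` and let `κ(x')` be the APEX LEVEL (the common value of `u` and `v` on the apex
hyperplane `u = v`, a `y`-free affine form), so that `u − κ = A φ`, `v − κ = (A + 1) φ`:
* `RebasePos.good_belowApex` (`A + 1 < 0`: the band lies between the letter and its apex level,
  `u < v < κ`): Janus extension of the upper bound up to `κ` (`RebasePos.janusExtendHi`); the upper
  wedge `{v < t < κ}` is FARTHER from the letter than the band, so its letter factor is dominated
  with constant `1` and its fibres are `|A + 1|⁻¹`-proportional to those of the band
  (`RebasePos.integrableOn_wedge_hi`); both pieces have the `y`-free upper bound `κ` (product case).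
  Registered as `rebaseSimplePos_belowApex`.
* `RebasePos.good_aboveApexNear` (`A ≥ 0`: the band lies above its apex level, `0 < κ ≤ u < v`),
  in the NEAR REGIME `v ≤ C κ` on the base cell: Janus extension of the lower bound down to `κ`
  (`RebasePos.janusExtendLo`, wedge `{κ < t < u}` by `RebasePos.integrableOn_wedge_near`).
  Registered as `rebaseSimplePos_aboveApexNear`. The far regime `v ≫ κ` of this case, the apex
  level below the letter (`κ < 0`) and parallel bounds are the residue of the one-fibre rebase.
(`−1 < A < 0` is `rebaseSimplePos_levelSplit` at `κ`; `κ = 0` is `rebaseSimplePos_coaxial`.)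

References: M. Kontsevich, D. Zagier, *Periods* (2001), §1.2, rules (1a), (2).
-/

noncomputable section

open Set MeasureTheory MvPolynomial
open Literature.NumberTheory.Transcendental Literature.ModelTheory.ExponentialFields

namespace Summit.KontsevichZagierPeriods.ArrangementNormalForm.JanusBands

namespace RebasePos

open SeparatePos

section Apex

variable {B m m' : ℕ}

/-- **The upper wedge of one lettered fibre** is dominated with constant `1`: with
`D = {θ < t < θ'}` the domain of `s` (letter `c < θ` on the base cell) and a level `κ ≥ θ'` with
`λ (κ − θ') ≤ θ' − θ` (`λ > 0` rational), the literal integrand is absolutely integrable on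
`W = {θ' < t < κ}` (the substitution `t ↦ θ' − λ (κ − t)` maps `W` into `D`, below itself). -/
theorem integrableOn_wedge_hi (s : KZ.IntegralRep (B + 1 + 1)) (M : Fin m' → (Fin (B + 1) → ℚ) × ℚ)
    (p : MvPolynomial (Fin B) ℚ) (L : Fin m → (Fin B → ℚ) × ℚ) (e : Fin m → ℕ)
    (ℓ₁ ℓ₂ : (Fin B → ℚ) × ℚ) (n₁ n₂ : ℕ) (c θ θ' κ : (Fin (B + 1) → ℚ) × ℚ)
    (hdom : s.domain = gDom B 1 m' M (fun _ => Sum.inr θ) (fun _ => Sum.inr θ'))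
    (hint : EqOn s.integrand (glit B 1 p L e ℓ₁ ℓ₂ n₁ n₂ (fun _ => some c)) s.domain)
    (lam : ℚ) (hlam : 0 < lam)
    (hgeom : ∀ z : Fin (B + 1 + 1) → ℝ, (∀ j, 0 < affF B 1 (M j) z) →
      affF B 1 c z < affF B 1 θ z ∧ affF B 1 θ' z ≤ affF B 1 κ z ∧
      (lam : ℝ) * (affF B 1 κ z - affF B 1 θ' z) ≤ affF B 1 θ' z - affF B 1 θ z) :
    IntegrableOn (glit B 1 p L e ℓ₁ ℓ₂ n₁ n₂ (fun _ => some c))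
      (gDom B 1 m' M (fun _ => Sum.inr θ') (fun _ => Sum.inr κ)) := by
  set W := gDom B 1 m' M (fun _ => Sum.inr θ') (fun _ => Sum.inr κ) with hW
  set d : (Fin (B + 1) → ℚ) × ℚ := θ' - lam • κ with hd
  set μ : Fin 1 → ℚ := fun _ => lam with hμ
  set α : Fin 1 → ℚ := fun _ => d.1 (Fin.last B) with hα
  set δ : Fin 1 → (Fin B → ℚ) × ℚ := fun _ => restr B d with hδ
  have hlam' : (0 : ℝ) < lam := by exact_mod_cast hlam
  have hΨt : ∀ w, pullInv μ α δ w (Fin.natAdd (B + 1) 0) =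
      (lam : ℝ) * w (Fin.natAdd (B + 1) 0) + (affF B 1 θ' w - (lam : ℝ) * affF B 1 κ w) := by
    intro w
    rw [pullInv_fib, ← affF_sub_smul, affF_split d w, add_assoc]
  have hmaps : MapsTo (pullInv μ α δ) W s.domain := by
    intro w hw
    rw [hW, mem_gDom_one] at hw
    obtain ⟨hrow, h1, h2⟩ := hw
    obtain ⟨-, -, hlen⟩ := hgeom w hrow
    rw [hdom, mem_gDom_one]
    refine ⟨fun j => by rw [affF_pullInv]; exact hrow j, ?_, ?_⟩
    · rw [affF_pullInv, hΨt]
      nlinarith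
    · rw [affF_pullInv, hΨt]
      nlinarith
  have hfD : IntegrableOn (glit B 1 p L e ℓ₁ ℓ₂ n₁ n₂ (fun _ => some c)) s.domain :=
    s.integrableOn.congr_fun hint (KZ.IntegralRep.measurableSet_domain_holds s)
  refine integrableOn_of_le_comp_pullInv μ α δ (fun _ => hlam.ne') (isSemialgebraic_gDom _ _ _ _)
    (isSemialgebraicFunOn_glit (isSemialgebraic_gDom _ _ _ _) _ _ _ _ _ _ _ _) hfD hmaps 1
    fun w hw => ?_
  rw [hW, mem_gDom_one] at hw
  obtain ⟨hrow, h1, h2⟩ := hw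
  obtain ⟨hcθ, hθκ, hlen⟩ := hgeom w hrow
  rw [glit_one, glit_one]
  simp only [affB_pullInv, pullInv_base, affF_pullInv, hΨt]
  set G := MvPolynomial.aeval (fun i => w (Fin.castAdd 1 (Fin.castSucc i))) p /
      (∏ j, (affB B 1 (L j) w) ^ e j) *
      ((w (Fin.castAdd 1 (Fin.last B)) - affB B 1 ℓ₁ w) ^ n₁ /
        (w (Fin.castAdd 1 (Fin.last B)) - affB B 1 ℓ₂ w) ^ n₂) with hG
  set t := w (Fin.natAdd (B + 1) 0) with ht
  have hpos' : 0 < (lam : ℝ) * t + (affF B 1 θ' w - (lam : ℝ) * affF B 1 κ w) - affF B 1 c w := by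
    nlinarith
  have hkey : (lam : ℝ) * t + (affF B 1 θ' w - (lam : ℝ) * affF B 1 κ w) - affF B 1 c w ≤
      1 * (t - affF B 1 c w) := by
    nlinarith
  have hpos : 0 < t - affF B 1 c w := by linarith
  have key : ∀ G a b' : ℝ, 0 < a → 0 < b' → b' ≤ 1 * a → |G * (1 / a)| ≤ 1 * |G * (1 / b')| := by
    intro G a b' ha hb' h
    rw [abs_mul, abs_mul, abs_of_pos (one_div_pos.2 ha), abs_of_pos (one_div_pos.2 hb'),
      mul_left_comm]
    refine mul_le_mul_of_nonneg_left ?_ (abs_nonneg G)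
    rw [mul_one_div, div_le_div_iff₀ ha hb', one_mul]
    exact h
  exact key G _ _ hpos hpos' hkey

/-- Updating the only value of a function on `Fin 1`. -/
theorem update_fin_one {X : Type*} (f : Fin 1 → X) (x : X) : Function.update f 0 x = fun _ => x :=
  funext fun j => by rw [Subsingleton.elim j 0, Function.update_self]

/-- Goodness from a Janus extension `[T] − [s] − [W] ∈ KZ.relations`. -/
theorem good_of_janus {S : Set KZ.FormalRep} {xT x xW : KZ.FormalRep}
    (hrel : xT - x - xW ∈ KZ.relations) (hT : ∃ c ∈ AddSubgroup.closure S, xT - c ∈ KZ.relations)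
    (hW : ∃ c ∈ AddSubgroup.closure S, xW - c ∈ KZ.relations) :
    ∃ c ∈ AddSubgroup.closure S, x - c ∈ KZ.relations := by
  obtain ⟨cT, hcT, hxT⟩ := hT
  obtain ⟨cW, hcW, hxW⟩ := hW
  refine ⟨cT - cW, sub_mem hcT hcW, ?_⟩
  have := sub_mem (sub_mem hxT hxW) hrel
  rwa [show xT - cT - (xW - cW) - (xT - x - xW) = x - (cT - cW) by abel] at this

/-- A bound for full-base affine forms on coordinatewise bounded points. -/
theorem abs_affF_le (d : (Fin (B + 1) → ℚ) × ℚ) {z : Fin (B + 1 + 1) → ℝ} {R : ℝ}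
    (hz : ∀ j : Fin (B + 1), |z (Fin.castAdd 1 j)| ≤ R) :
    |affF B 1 d z| ≤ (∑ j, |(d.1 j : ℝ)|) * R + |(d.2 : ℝ)| := by
  unfold affF
  refine (abs_add_le _ _).trans (add_le_add ?_ le_rfl)
  refine (Finset.abs_sum_le_sum_abs _ _).trans ?_
  rw [Finset.sum_mul]
  refine Finset.sum_le_sum fun j _ => ?_
  rw [abs_mul]
  exact mul_le_mul_of_nonneg_left (hz j) (abs_nonneg _)

/-- **Boundedness of one-fibre literal domains over the base cell of a bounded non-degenerate
band.** If `D = {rows, θ < t < θ'}` is bounded and its fibres over the base cell are non-empty,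
then every `{rows, θ₁ < t < θ₂}` with affine `θ₁`, `θ₂` is bounded. -/
theorem isBounded_gDom_one (M : Fin m' → (Fin (B + 1) → ℚ) × ℚ) (θ θ' θ₁ θ₂ : (Fin (B + 1) → ℚ) × ℚ)
    (hbd : Bornology.IsBounded (gDom B 1 m' M (fun _ => Sum.inr θ) (fun _ => Sum.inr θ')))
    (hne : ∀ z : Fin (B + 1 + 1) → ℝ, (∀ j, 0 < affF B 1 (M j) z) → affF B 1 θ z < affF B 1 θ' z) :
    Bornology.IsBounded (gDom B 1 m' M (fun _ => Sum.inr θ₁) (fun _ => Sum.inr θ₂)) := by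
  obtain ⟨R, -, hR⟩ := hbd.exists_pos_norm_le
  set R₁ : ℝ := (∑ j, |(θ₁.1 j : ℝ)|) * R + |(θ₁.2 : ℝ)| with hR₁
  set R₂ : ℝ := (∑ j, |(θ₂.1 j : ℝ)|) * R + |(θ₂.2 : ℝ)| with hR₂
  rw [isBounded_iff_forall_norm_le]
  refine ⟨max (max R 0) (max R₁ R₂), fun z hz => ?_⟩
  rw [mem_gDom_one] at hz
  obtain ⟨hrow, h1, h2⟩ := hz
  set z' : Fin (B + 1 + 1) → ℝ :=
    Function.update z (Fin.natAdd (B + 1) 0) ((affF B 1 θ z + affF B 1 θ' z) / 2) with hz'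
  have hbase : ∀ j : Fin (B + 1), z' (Fin.castAdd 1 j) = z (Fin.castAdd 1 j) := fun j => by
    rw [hz', Function.update_of_ne]
    intro h
    have := congrArg Fin.val h
    simp at this
    omega
  have haff : ∀ d, affF B 1 d z' = affF B 1 d z := fun d => by simp [affF, hbase]
  have hz'D : z' ∈ gDom B 1 m' M (fun _ => Sum.inr θ) (fun _ => Sum.inr θ') := by
    rw [mem_gDom_one]
    simp only [haff]
    have hlt := hne z hrow
    refine ⟨hrow, ?_, ?_⟩ <;> rw [hz', Function.update_self] <;> linarith
  have hRz : ∀ j : Fin (B + 1), |z (Fin.castAdd 1 j)| ≤ R := fun j => by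
    have h := norm_le_pi_norm z' (Fin.castAdd 1 j)
    rw [Real.norm_eq_abs, hbase] at h
    exact h.trans (hR z' hz'D)
  rw [pi_norm_le_iff_of_nonneg (le_trans (le_max_right R 0) (le_max_left _ _))]
  intro l
  rw [Real.norm_eq_abs]
  refine Fin.addCases (fun j => ((hRz j).trans (le_max_left _ _)).trans (le_max_left _ _)) (fun i => ?_) l
  rw [Subsingleton.elim i 0]
  have hθ₁ := abs_affF_le θ₁ hRz
  have hθ₂ := abs_affF_le θ₂ hRz
  refine le_trans ?_ (le_max_right _ _)
  rw [abs_le] at hθ₁ hθ₂ ⊢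
  constructor
  · exact le_trans (by linarith [le_max_left R₁ R₂] : -max R₁ R₂ ≤ -R₁) (by linarith)
  · exact le_trans (by linarith : z (Fin.natAdd (B + 1) 0) ≤ R₂) (le_max_right _ _)

variable (L : Fin m → (Fin B → ℚ) × ℚ) (e : Fin m → ℕ) (ℓ₁ ℓ₂ : (Fin B → ℚ) × ℚ) (n₁ n₂ : ℕ)

/-- **Band between its letter and its apex level** (`u < v < κ`, `u − κ = A (v − u)` with
`A + 1 < 0`, `κ` parallel in `y` to the letter `0`): Janus extension of the upper bound up to
`κ`; the upper wedge is dominated; both pieces are in the product case. -/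
theorem good_belowApex (s : KZ.IntegralRep (B + 1 + 1)) (M : Fin m' → (Fin (B + 1) → ℚ) × ℚ)
    (p : MvPolynomial (Fin B) ℚ) (u v κ : (Fin (B + 1) → ℚ) × ℚ) (A : ℚ) (h12 : n₁ = 0 ∨ n₂ = 0)
    (hbd : Bornology.IsBounded s.domain)
    (hdom : s.domain = gDom B 1 m' M (fun _ => Sum.inr u) (fun _ => Sum.inr v))
    (hint : EqOn s.integrand (glit B 1 p L e ℓ₁ ℓ₂ n₁ n₂ (fun _ => some 0)) s.domain)
    (hκ : κ.1 (Fin.last B) = 0) (hA : u - κ = A • (v - u)) (hA1 : A + 1 < 0)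
    (hcell : ∀ z : Fin (B + 1 + 1) → ℝ, (∀ j, 0 < affF B 1 (M j) z) →
      0 < affF B 1 u z ∧ affF B 1 u z < affF B 1 v z) :
    ∃ c ∈ AddSubgroup.closure (GGset B 2 1), KZ.of s - c ∈ KZ.relations := by
  -- affine identities
  have huκ : ∀ z : Fin (B + 1 + 1) → ℝ, affF B 1 u z - affF B 1 κ z =
      (A : ℝ) * (affF B 1 v z - affF B 1 u z) := fun z => by
    have key := congrArg (fun q => affF B 1 q z) hA
    simp only [affF_sub'', affF_smul'] at key
    exact key
  have hvκ : ∀ z : Fin (B + 1 + 1) → ℝ, affF B 1 v z - affF B 1 κ z =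
      ((A : ℝ) + 1) * (affF B 1 v z - affF B 1 u z) := fun z => by linarith [huκ z]
  have hA1' : (A : ℝ) + 1 < 0 := by exact_mod_cast hA1
  set lam : ℚ := (-(A + 1))⁻¹ with hlam_def
  have hlam : 0 < lam := inv_pos.2 (by linarith)
  have hlamR : (lam : ℝ) * (-((A : ℝ) + 1)) = 1 := by
    rw [hlam_def, Rat.cast_inv, Rat.cast_neg, Rat.cast_add, Rat.cast_one]
    exact inv_mul_cancel₀ (neg_ne_zero.2 hA1'.ne)
  have hvκle : ∀ z : Fin (B + 1 + 1) → ℝ, (∀ j, 0 < affF B 1 (M j) z) → affF B 1 v z ≤ affF B 1 κ z :=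
    fun z hz => by nlinarith [hvκ z, (hcell z hz).2]
  -- the upper wedge converges
  have hWint : IntegrableOn (glit B 1 p L e ℓ₁ ℓ₂ n₁ n₂ (fun _ => some 0))
      (gDom B 1 m' M (fun _ => Sum.inr v) (fun _ => Sum.inr κ)) :=
    integrableOn_wedge_hi s M p L e ℓ₁ ℓ₂ n₁ n₂ 0 u v κ hdom hint lam hlam fun z hz => by
      obtain ⟨hu0, huv⟩ := hcell z hz
      refine ⟨by rwa [affF_zero''], hvκle z hz, le_of_eq ?_⟩
      have h1 := hvκ z
      linear_combination (-(lam : ℝ)) * h1 + (affF B 1 v z - affF B 1 u z) * hlamR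
  -- Janus extension of the upper bound
  obtain ⟨sT, sW, hdT, hiT, hbdT, hdW, hiW, hbdW, hrel⟩ := janusExtendHi s M (fun _ => Sum.inr u)
    (fun _ => Sum.inr v) hdom L e p ℓ₁ ℓ₂ n₁ n₂ (fun _ => some 0) hint 0 v κ rfl hvκle
    (fun z hz => le_of_lt (hcell z hz.1).2) (by rw [update_fin_one, update_fin_one]; exact hWint)
    (by rw [update_fin_one]; exact isBounded_gDom_one M u v u κ (hdom ▸ hbd) fun z hz => (hcell z hz).2)
  rw [update_fin_one] at hdT hdW
  rw [update_fin_one] at hdW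
  have hκ0 : ∀ c : (Fin (B + 1) → ℚ) × ℚ, some (0 : (Fin (B + 1) → ℚ) × ℚ) = some c →
      κ.1 (Fin.last B) = c.1 (Fin.last B) := fun c hc => by cases hc; simpa using hκ
  refine good_of_janus hrel ?_ ?_
  · exact good_product (fun _ => some 0) (fun _ => u) (fun _ => κ) sT M L e p ℓ₁ ℓ₂
      (fun _ => Sum.inr u) (fun _ => Sum.inr κ) h12 hbdT hdT (by rw [hiT]; exact fun _ _ => rfl)
      (fun _ => rfl) (fun _ => rfl) fun _ c hc => Or.inr (hκ0 c hc)
  · exact good_product (fun _ => some 0) (fun _ => v) (fun _ => κ) sW M L e p ℓ₁ ℓ₂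
      (fun _ => Sum.inr v) (fun _ => Sum.inr κ) h12 hbdW hdW (by rw [hiW]; exact fun _ _ => rfl)
      (fun _ => rfl) (fun _ => rfl) fun _ c hc => Or.inr (hκ0 c hc)

/-- **Band above its apex level, near regime** (`0 < κ ≤ u < v`, `u − κ = A (v − u)` with
`A ≥ 0`, `κ` parallel in `y` to the letter `0`, and `v ≤ C κ` on the base cell): Janus extension
of the lower bound down to `κ`; the lower wedge converges by `integrableOn_wedge_near`; both pieces
are in the product case. -/
theorem good_aboveApexNear (s : KZ.IntegralRep (B + 1 + 1)) (M : Fin m' → (Fin (B + 1) → ℚ) × ℚ)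
    (p : MvPolynomial (Fin B) ℚ) (u v κ : (Fin (B + 1) → ℚ) × ℚ) (A : ℚ) (C : ℝ)
    (h12 : n₁ = 0 ∨ n₂ = 0) (hbd : Bornology.IsBounded s.domain)
    (hdom : s.domain = gDom B 1 m' M (fun _ => Sum.inr u) (fun _ => Sum.inr v))
    (hint : EqOn s.integrand (glit B 1 p L e ℓ₁ ℓ₂ n₁ n₂ (fun _ => some 0)) s.domain)
    (hκ : κ.1 (Fin.last B) = 0) (hA : u - κ = A • (v - u)) (hA0 : 0 ≤ A)
    (hcell : ∀ z : Fin (B + 1 + 1) → ℝ, (∀ j, 0 < affF B 1 (M j) z) →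
      0 < affF B 1 κ z ∧ affF B 1 u z < affF B 1 v z ∧ affF B 1 v z ≤ C * affF B 1 κ z) :
    ∃ c ∈ AddSubgroup.closure (GGset B 2 1), KZ.of s - c ∈ KZ.relations := by
  have hκ0 : ∀ c : (Fin (B + 1) → ℚ) × ℚ, some (0 : (Fin (B + 1) → ℚ) × ℚ) = some c →
      κ.1 (Fin.last B) = c.1 (Fin.last B) := fun c hc => by cases hc; simpa using hκ
  have huκ : ∀ z : Fin (B + 1 + 1) → ℝ, affF B 1 u z - affF B 1 κ z =
      (A : ℝ) * (affF B 1 v z - affF B 1 u z) := fun z => by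
    have key := congrArg (fun q => affF B 1 q z) hA
    simp only [affF_sub'', affF_smul'] at key
    exact key
  rcases eq_or_lt_of_le hA0 with hA00 | hApos
  · -- `A = 0`: the lower bound is the apex level itself
    have huκ' : u = κ := by
      have h := hA
      rw [← hA00, zero_smul, sub_eq_zero] at h
      exact h
    exact good_product (fun _ => some 0) (fun _ => u) (fun _ => v) s M L e p ℓ₁ ℓ₂
      (fun _ => Sum.inr u) (fun _ => Sum.inr v) h12 hbd hdom hint (fun _ => rfl) (fun _ => rfl)
      fun _ c hc => Or.inl (by rw [huκ']; exact hκ0 c hc)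
  have hApos' : (0 : ℝ) < A := by exact_mod_cast hApos
  have hκu : ∀ z : Fin (B + 1 + 1) → ℝ, (∀ j, 0 < affF B 1 (M j) z) → affF B 1 κ z ≤ affF B 1 u z :=
    fun z hz => by nlinarith [huκ z, (hcell z hz).2.1]
  -- the lower wedge converges (near regime)
  have hWint : IntegrableOn (glit B 1 p L e ℓ₁ ℓ₂ n₁ n₂ (fun _ => some 0))
      (gDom B 1 m' M (fun _ => Sum.inr κ) (fun _ => Sum.inr u)) :=
    integrableOn_wedge_near s M p L e ℓ₁ ℓ₂ n₁ n₂ 0 u v κ hdom hint A⁻¹ C (inv_pos.2 hApos)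
      fun z hz => by
        obtain ⟨hκ0', huv, hvC⟩ := hcell z hz
        refine ⟨by rwa [affF_zero''], hκu z hz, le_of_eq ?_, by rwa [affF_zero'', sub_zero, sub_zero]⟩
        rw [huκ z, Rat.cast_inv, ← mul_assoc, inv_mul_cancel₀ hApos'.ne', one_mul]
  obtain ⟨sT, sW, hdT, hiT, hbdT, hdW, hiW, hbdW, hrel⟩ := janusExtendLo s M (fun _ => Sum.inr u)
    (fun _ => Sum.inr v) hdom L e p ℓ₁ ℓ₂ n₁ n₂ (fun _ => some 0) hint 0 u κ rfl hκu
    (fun z hz => le_of_lt (hcell z hz.1).2.1) (by rw [update_fin_one, update_fin_one]; exact hWint)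
    (by rw [update_fin_one]; exact isBounded_gDom_one M u v κ v (hdom ▸ hbd) fun z hz => (hcell z hz).2.1)
  rw [update_fin_one] at hdT hdW
  rw [update_fin_one] at hdW
  refine good_of_janus hrel ?_ ?_
  · exact good_product (fun _ => some 0) (fun _ => κ) (fun _ => v) sT M L e p ℓ₁ ℓ₂
      (fun _ => Sum.inr κ) (fun _ => Sum.inr v) h12 hbdT hdT (by rw [hiT]; exact fun _ _ => rfl)
      (fun _ => rfl) (fun _ => rfl) fun _ c hc => Or.inl (hκ0 c hc)
  · exact good_product (fun _ => some 0) (fun _ => κ) (fun _ => u) sW M L e p ℓ₁ ℓ₂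
      (fun _ => Sum.inr κ) (fun _ => Sum.inr u) h12 hbdW hdW (by rw [hiW]; exact fun _ _ => rfl)
      (fun _ => rfl) (fun _ => rfl) fun _ c hc => Or.inl (hκ0 c hc)

end Apex

end RebasePos

/-- **Registered part of `stub_rebaseSimplePos` / `rebaseSimplePos_oneFibre` (line `janus-bands`,
v6.2): a band between its letter and its apex level.** One lettered fibre over a base of dimension
`B + 1` with letter `0`, affine bounds `0 < u < v` on the base cell, a `y`-free level `κ` with
`u − κ = A (v − u)`, `A + 1 < 0` (so `u < v < κ`: `κ` is the apex level and the band lies below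
it): `[s]` is congruent modulo `KZ.relations` to the subgroup generated by `GG B 2 1`
(`RebasePos.good_belowApex`: Janus extension up to `κ` with a dominated upper wedge, rule 1a,
then two affine pull-backs, rule 2; uniformly in the silent base coordinates). -/
theorem rebaseSimplePos_belowApex (B m m' n₁ n₂ : ℕ) (s : KZ.IntegralRep (B + 1 + 1)) (M : Fin m' → (Fin (B + 1) → ℚ) × ℚ) (L : Fin m → (Fin B → ℚ) × ℚ) (e : Fin m → ℕ) (p : MvPolynomial (Fin B) ℚ) (ℓ₁ ℓ₂ : (Fin B → ℚ) × ℚ) (c u v κ : (Fin (B + 1) → ℚ) × ℚ) (A : ℚ) (h12 : n₁ = 0 ∨ n₂ = 0) (hbd : Bornology.IsBounded s.domain) (hdom : s.domain = {z | (∀ j, 0 < ∑ i, ((M j).1 i : ℝ) * z (Fin.castAdd 1 i) + ((M j).2 : ℝ)) ∧ ∀ i, Sum.elim (fun j => z (Fin.natAdd (B + 1) j)) (fun c => ∑ i', (c.1 i' : ℝ) * z (Fin.castAdd 1 i') + (c.2 : ℝ)) (Sum.inr u : Fin 1 ⊕ ((Fin (B + 1) → ℚ) × ℚ)) < z (Fin.natAdd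 (B + 1) i) ∧ z (Fin.natAdd (B + 1) i) < Sum.elim (fun j => z (Fin.natAdd (B + 1) j)) (fun c => ∑ i', (c.1 i' : ℝ) * z (Fin.castAdd 1 i') + (c.2 : ℝ)) (Sum.inr v : Fin 1 ⊕ ((Fin (B + 1) → ℚ) × ℚ))}) (hint : EqOn s.integrand (fun z => MvPolynomial.aeval (fun i => z (Fin.castAdd 1 (Fin.castSucc i))) p / (∏ j, (∑ i, ((L j).1 i : ℝ) * z (Fin.castAdd 1 (Fin.castSucc i)) + ((L j).2 : ℝ)) ^ e j) * ((z (Fin.castAdd 1 (Fin.last B)) - (∑ i, (ℓ₁.1 i : ℝ) * z (Fin.castAdd 1 (Fin.castSucc i)) + (ℓ₁.2 : ℝ))) ^ n₁ / (z (Fin.castAdd 1 (Fin.last B)) - (∑ i, (ℓ₂.1 i : ℝ) * z (Fin.castAdd 1 (Fin.castSucc i)) + (ℓ₂.2 : ℝ))) ^ n₂) * ∏ i : Fin 1, (1 / (z (Fin.natAdd (B + 1) i) - (∑ i', (c.1 i' : ℝ) * z (Fin.castAdd 1 i') + (c.2 : ℝ))))) s.domain) (hc : c = 0) (hκ : κ.1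 (Fin.last B) = 0) (hA : u - κ = A • (v - u)) (hA1 : A + 1 < 0) (hcell : ∀ z : Fin (B + 1 + 1) → ℝ, (∀ j, 0 < ∑ i, ((M j).1 i : ℝ) * z (Fin.castAdd 1 i) + ((M j).2 : ℝ)) → 0 < (∑ i, (u.1 i : ℝ) * z (Fin.castAdd 1 i) + (u.2 : ℝ)) ∧ (∑ i, (u.1 i : ℝ) * z (Fin.castAdd 1 i) + (u.2 : ℝ)) < (∑ i, (v.1 i : ℝ) * z (Fin.castAdd 1 i) + (v.2 : ℝ))) : ∃ c' ∈ AddSubgroup.closure (SeparatePos.GGset B 2 1), KZ.of s - c' ∈ KZ.relations := by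
  subst hc
  exact RebasePos.good_belowApex L e ℓ₁ ℓ₂ n₁ n₂ s M p u v κ A h12 hbd hdom hint hκ hA hA1 hcell

/-- **Registered part of `stub_rebaseSimplePos` / `rebaseSimplePos_oneFibre` (line `janus-bands`,
v6.2): a band above its apex level, near regime.** One lettered fibre over a base of dimension
`B + 1` with letter `0`, affine bounds `u < v`, a `y`-free level `κ` with `u − κ = A (v − u)`,
`A ≥ 0` (so `κ ≤ u < v`: the band lies above its apex level), and on the base cell `0 < κ` and
`v ≤ C κ` (the NEAR REGIME: the letter stays at distance comparable to the band's height below the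
apex): `[s]` is congruent modulo `KZ.relations` to the subgroup generated by `GG B 2 1`
(`RebasePos.good_aboveApexNear`: Janus extension down to `κ`, lower wedge by
`rebaseSimplePos_wedgeNear`). The complementary FAR REGIME (`v ≫ κ` near the common zero set of
`κ` and `v − u`) is the non-dominated residue of the one-fibre rebase. -/
theorem rebaseSimplePos_aboveApexNear (B m m' n₁ n₂ : ℕ) (s : KZ.IntegralRep (B + 1 + 1)) (M : Fin m' → (Fin (B + 1) → ℚ) × ℚ) (L : Fin m → (Fin B → ℚ) × ℚ) (e : Fin m → ℕ) (p : MvPolynomial (Fin B) ℚ) (ℓ₁ ℓ₂ : (Fin B → ℚ) × ℚ) (c u v κ : (Fin (B + 1) → ℚ) × ℚ) (A : ℚ) (C : ℝ) (h12 : n₁ = 0 ∨ n₂ = 0) (hbd : Bornology.IsBounded s.domain) (hdom : s.domain = {z | (∀ j, 0 < ∑ i, ((M j).1 i : ℝ) * z (Fin.castAdd 1 i) + ((M j).2 : ℝ)) ∧ ∀ i, Sum.elim (fun j => z (Fin.natAdd (B + 1) j)) (fun c => ∑ i', (c.1 i' : ℝ) * z (Fin.castAdd 1 i') + (c.2 :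 ℝ)) (Sum.inr u : Fin 1 ⊕ ((Fin (B + 1) → ℚ) × ℚ)) < z (Fin.natAdd (B + 1) i) ∧ z (Fin.natAdd (B + 1) i) < Sum.elim (fun j => z (Fin.natAdd (B + 1) j)) (fun c => ∑ i', (c.1 i' : ℝ) * z (Fin.castAdd 1 i') + (c.2 : ℝ)) (Sum.inr v : Fin 1 ⊕ ((Fin (B + 1) → ℚ) × ℚ))}) (hint : EqOn s.integrand (fun z => MvPolynomial.aeval (fun i => z (Fin.castAdd 1 (Fin.castSucc i))) p / (∏ j, (∑ i, ((L j).1 i : ℝ) * z (Fin.castAdd 1 (Fin.castSucc i)) + ((L j).2 : ℝ)) ^ e j) * ((z (Fin.castAdd 1 (Fin.last B)) - (∑ i, (ℓ₁.1 i : ℝ) * z (Fin.castAdd 1 (Fin.castSucc i)) + (ℓ₁.2 : ℝ))) ^ n₁ / (z (Fin.castAdd 1 (Fin.last B)) - (∑ i, (ℓ₂.1 i : ℝ) * z (Fin.castAdd 1 (Fin.castSucc i)) + (ℓ₂.2 : ℝ))) ^ n₂) * ∏ i : Fin 1, (1 / (z (Fin.natAdd (B + 1) i) - (∑ i', (c.1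 i' : ℝ) * z (Fin.castAdd 1 i') + (c.2 : ℝ))))) s.domain) (hc : c = 0) (hκ : κ.1 (Fin.last B) = 0) (hA : u - κ = A • (v - u)) (hA0 : 0 ≤ A) (hcell : ∀ z : Fin (B + 1 + 1) → ℝ, (∀ j, 0 < ∑ i, ((M j).1 i : ℝ) * z (Fin.castAdd 1 i) + ((M j).2 : ℝ)) → 0 < (∑ i, (κ.1 i : ℝ) * z (Fin.castAdd 1 i) + (κ.2 : ℝ)) ∧ (∑ i, (u.1 i : ℝ) * z (Fin.castAdd 1 i) + (u.2 : ℝ)) < (∑ i, (v.1 i : ℝ) * z (Fin.castAdd 1 i) + (v.2 : ℝ)) ∧ (∑ i, (v.1 i : ℝ) * z (Fin.castAdd 1 i) + (v.2 : ℝ)) ≤ C * (∑ i, (κ.1 i : ℝ) * z (Fin.castAdd 1 i) + (κ.2 : ℝ))) : ∃ c' ∈ AddSubgroup.closure (SeparatePos.GGset B 2 1), KZ.of s - c' ∈ KZ.relations := by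
  subst hc
  exact RebasePos.good_aboveApexNear L e ℓ₁ ℓ₂ n₁ n₂ s M p u v κ A C h12 hbd hdom hint hκ hA hA0 hcell


end Summit.KontsevichZagierPeriods.ArrangementNormalForm.JanusBands
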